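import Summits.CriticalPhenomena.PercolationContinuityZ3.Theorems.PercNearOneGluingNoHeavyQuantSGCLightCellsBothAssembly
import Summits.CriticalPhenomena.PercolationContinuityZ3.Theorems.PercNearOneGluingNoHeavyQuantTreeBuiltRows
import HarnessLib

/-!
# QUANT lane R8, T-DEC: the tree induction needs the single-gate closure ONLY FOR TREE-BUILT FACTORS — `SDECConvClosedTB` — and
# tree-built laws appear to be AD3⁺-decomposable (`TreeBuiltAD3`, exact census 0 / ≈ 32 000), so that
# `CW + PP + PT + TT + TreeBuiltAD3 ⟹ SDECConvClosedTB ⟹ TreeBuiltDEC ⟹ FarTreeRow` (kernel)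

builds on p205010 (kernel theorem, internal audit signed; external expert review pending)

Support file (`--supports stmt-CriticalPhenomena-4575`), QUANT lane, TYPER seat prim-quant-stmt (gen 31), rung R8 of
`run/shared/lean/prim/quant/LADDER.md`.  Two `@[conjecture]` definitions, one plain definition (a decomposition datum), theorems with standard
axioms, no sorries.  Continues census-2 g53's `…QuantSDEC` (`TreeBuilt`, `SDEC`, `SDECConvClosed`, the structural induction `treeBuilt_sdec`),
typer g30's `…QuantSGCLightCells` (cells L2/L3, `singleGateConvClosed_of_lightCells`) and typer g31's `…QuantSGCLightCellsBoth[Assembly]`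
(cells PP/PT/TT, `singleGateConvClosed_of_bothLightCells`).

THE POINT.  The lane's law-level target `SingleGateConvClosed` (and `SDECConvClosed`, `GateMove`) quantifies over ALL pairs of admissible
laws, but census-2 g53's structural induction (`treeBuilt_sdec`) only ever convolves TREE-BUILT laws (`LawDec.TreeBuilt x M μ`: the closure of
`δ₀`, `δ₁` under `lconv`, `gate`, floor-lowering = reached-relay counts of rooted forests below their least marginal).  The cell programme
"CW + light cells ⟹ SGC" (typer g30/g31) is complete EXCEPT for pairs of factors admitting no AD3⁺ decomposition, and the only known
obstruction (arm-2 g35's top-affordability-tight 4-atom vertex `{1: 4/27, 2: 1/54, 4: 5/54, 6: 20/27}`, `q = 9/10`, `y = 3/4`; typer g31: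
still non-AD3 at `y = 0.749`, AD3⁺ again at `y = 0.74`) is NOT tree-built at the floors where it fails (a zero-free law on `{1..6}` of mean
`5` needs a sure relay, so its least marginal is `≤ 4/5 < y/q`).  EXACT CENSUS (typer g31, `explore/ad3_tree.py`, `ad3_adversarial.py`,
`ad3_smallq.py`; exact rational LPs; the AD3⁺ test = membership of `μ` in the convex hull of the heavy pairs, the admissible light pairs and
the endpoints of the admissible sub-intervals of all three-atom mean-`T` segments on `supp μ`, the engine reproducing arm-2's negative
vertex): ≈ 2 800 distinct tree-built laws — random gated trees (`≤ 7` vertices, `≤ 6` relays, gates on `{k/12} ∪ {9/10, 19/20}`) and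
ADVERSARIAL families (stars = binomial laws, which are top-affordability-TIGHT at the limit floor; relay-stars; paths = one light far top;
spiders; hub + far blob; `≤ 8` relays) — at the limit floor `x =` least marginal and at `0.95x / 0.9x / 0.75x`, gates
`q ∈ {1, 9/10, 3/4, 2/3, 1/2, 2/5, 1/4, 1/10, 1/50}`: ≈ 32 000 (law, q, x) instances, EVERY ONE admissible (as `TreeBuiltDEC` predicts) and
EVERY ONE AD3⁺-decomposable; 0 exceptions.

THIS FILE.
* `LawDec.AD3Decomp y q T M μ` — the AD3⁺ decomposition datum (the hypothesis block `hcomp` of `singleGateConvClosed_of_lightCells` /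
  `_of_bothLightCells`): `μ = Σ_k v_k·ω_k`, `v ≥ 0`, `Σ v = 1`, every charged `ω_k` a heavy pair (`y ≤ qγ`), an admissible light pair
  (`qγ < y`, `gate_q ω_k` DEC at every layer `j′ < M` at floor `y`) or an admissible non-heavy-decomposable triple, all of mean `T` on `{0..M}`.
* `LawDec.TreeBuiltAD3` (`@[conjecture]`): every tree-built law `TreeBuilt x M μ` admits, for every gate `0 < q ≤ 1`, an AD3⁺ decomposition at
  `(y = q·x, q, mean μ, M)`.  Evidence above.  (Admissibility of the law itself is `TreeBuiltDEC`; the conjecture is about its DECOMPOSITION.)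
* `LawDec.SDECConvClosedTB` (`@[conjecture]`): `SDECConvClosed` restricted to tree-built factors — the weakest law-level closure the induction
  needs; trivially implied by `SDECConvClosed` (`sdecConvClosedTB_of_sdecConvClosed`) and by `SingleGateConvClosed`.
* **`LawDec.treeBuilt_sdec_TB`** — the structural induction from `SDECConvClosedTB` (census-2 g53's `treeBuilt_sdec` verbatim, carrying
  `TreeBuilt` along); **`treeBuiltDEC_of_sdecConvClosedTB`**, **`farTreeRow_of_sdecConvClosedTB : SDECConvClosedTB → FarTreeRow`**.
* **`LawDec.sdecConvClosedTB_of_lightCells : WindowMixDEC → SGCLightPair → SGCLightTriple → TreeBuiltAD3 → SDECConvClosedTB`** (one factor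
  decomposed, typer g30's reduction) and **`LawDec.sdecConvClosedTB_of_bothLightCells : WindowMixDEC → SGCLightPairPair → SGCLightPairTriple →
  SGCLightTripleTriple → TreeBuiltAD3 → SDECConvClosedTB`** (both factors decomposed, typer g31's reduction — explicit cells only).
* **`farTreeRow_of_bothLightCells : WindowMixDEC → SGCLightPairPair → SGCLightPairTriple → SGCLightTripleTriple → TreeBuiltAD3 → FarTreeRow`**,
  `farTreeRow_of_lightCells` (the L2/L3 form).
So R8 on trees follows from: CW (its blob node `GatedSliceMixLaw'` is a closed cell list nearly all kernel), three EXPLICIT finite-parameter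
light cells, and ONE structural conjecture about tree-built laws.  HONEST STATUS: `TreeBuiltAD3`, `SDECConvClosedTB`, PP/PT/TT, L2/L3, CW, SGC,
`GateMove`, `TreeDEC`, `FarTreeRow` are OPEN; nothing here is a published result; RATE class log\* / honest sentence unchanged.

[this work]; `TreeBuilt`/`SDEC`/induction: prim-quant-census-2 g53; bridge `farTreeRow_of_treeBuiltDEC`: lead g20 / typer g26; cells: typer g30,
arm-2 g35 (this lane).  The gluing rows served [cite: KozmaNitzan2024, Conjecture 3 (p. 15)]; product measure [cite: Grimmett1999, §1.3 p. 10].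
-/

noncomputable section

namespace Summit.CriticalPhenomena.PercolationContinuityZ3.Theorems

namespace Quant

open Finset

/-- two-point law notation `TP[lo, hi, g, h] = g·[h = hi] + (1 − g)·[h = lo]` (as in the lane's other files). -/
local notation3 "TP[" lo ", " hi ", " g ", " h "]" =>
  (g : ℝ) * (if (h : ℕ) = (hi : ℕ) then (1 : ℝ) else 0) + (1 - (g : ℝ)) * (if (h : ℕ) = (lo : ℕ) then (1 : ℝ) else 0)

/-- three-atom law notation `TR[s₁, s₂, s₃, p₁, p₂, p₃, h] = p₁·[h = s₁] + p₂·[h = s₂] + p₃·[h = s₃]`. -/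
local notation3 "TR[" s₁ ", " s₂ ", " s₃ ", " p₁ ", " p₂ ", " p₃ ", " h "]" =>
  (p₁ : ℝ) * (if (h : ℕ) = (s₁ : ℕ) then (1 : ℝ) else 0) + (p₂ : ℝ) * (if (h : ℕ) = (s₂ : ℕ) then (1 : ℝ) else 0)
    + (p₃ : ℝ) * (if (h : ℕ) = (s₃ : ℕ) then (1 : ℝ) else 0)

namespace LawDec

/-! ### The AD3⁺ decomposition datum and the two conjectures -/

/-- **AD3⁺ DECOMPOSITION** of a law `μ` on `{0..M}` at floor `y`, gate `q`, mean `T`: `μ = Σ_k v_k·ω_k` is a finite mixture (`v ≥ 0`,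
`Σ v = 1`) whose charged components are laws on `{0..M}` of mean `T`, each (H) a heavy pair `{lo, hi; γ}` (`y ≤ q·γ`), (L2) a light pair
(`q·γ < y`) whose gated version `gate_q ω_k` is DEC at every layer `j′ < M` at floor `y`, or (L3) a three-atom law with positive masses,
NOT heavy-decomposable, whose gated version is DEC at every layer — verbatim the hypothesis block of `singleGateConvClosed_of_lightCells` /
`singleGateConvClosed_of_bothLightCells`. [this work] -/
def AD3Decomp (y q T : ℝ) (M : ℕ) (μ : ℕ → ℝ) : Prop :=
  ∃ (κ : Type) (_ : Fintype κ) (v : κ → ℝ) (ω : κ → ℕ → ℝ),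
    (∀ k, 0 ≤ v k) ∧ (∑ k, v k = 1) ∧ (∀ h, μ h = ∑ k, v k * ω k h) ∧
    (∀ k, 0 < v k →
      (∃ (lo hi : ℕ) (γ : ℝ), lo ≤ hi ∧ hi ≤ M ∧ 0 ≤ γ ∧ γ ≤ 1 ∧ y ≤ q * γ ∧
          (lo : ℝ) + ((hi : ℝ) - lo) * γ = T ∧ ω k = fun h => TP[lo, hi, γ, h]) ∨
      (∃ (lo hi : ℕ) (γ : ℝ), lo < hi ∧ hi ≤ M ∧ 0 ≤ γ ∧ γ ≤ 1 ∧ q * γ < y ∧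
          (lo : ℝ) + ((hi : ℝ) - lo) * γ = T ∧ (∀ j', j' < M → DECAt y j' M (gate (fun h => TP[lo, hi, γ, h]) q)) ∧
          ω k = fun h => TP[lo, hi, γ, h]) ∨
      (∃ (s₁ s₂ s₃ : ℕ) (p₁ p₂ p₃ : ℝ), s₁ < s₂ ∧ s₂ < s₃ ∧ s₃ ≤ M ∧ 0 < p₁ ∧ 0 < p₂ ∧ 0 < p₃ ∧ p₁ + p₂ + p₃ = 1 ∧
          p₁ * (s₁ : ℝ) + p₂ * (s₂ : ℝ) + p₃ * (s₃ : ℝ) = T ∧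
          ((s₂ : ℝ) ≤ T ∧ q * (T - s₂) < y * ((s₃ : ℝ) - s₂) ∨ T < (s₂ : ℝ) ∧ q * (T - s₁) < y * ((s₃ : ℝ) - s₁)) ∧
          (∀ j', j' < M → DECAt y j' M (gate (fun h => TR[s₁, s₂, s₃, p₁, p₂, p₃, h]) q)) ∧
          ω k = fun h => TR[s₁, s₂, s₃, p₁, p₂, p₃, h]))

/-- **CONJECTURE `TreeBuiltAD3` (typer g31): every tree-built law is AD3⁺-decomposable at every gate.**  For `TreeBuilt x M μ` (census-2
g53: reached-relay count laws of rooted forests at a floor below their least marginal) and every gate `0 < q ≤ 1`, the law `μ` admits an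
AD3⁺ decomposition at floor `q·x`, gate `q`, its own mean and top `M`.  EVIDENCE (exact census, typer g31): ≈ 32 000 (law, q, x) instances
over ≈ 2 800 distinct tree-built laws (random gated trees and adversarial stars/paths/spiders/hub-and-blob families, limit floor and below,
`q` from `1` down to `1/50`): 0 exceptions — whereas the unrestricted admissible polytope has non-AD3⁺ vertices (arm-2 g35).  With CW and
the three explicit light cells it gives `FarTreeRow` (`farTreeRow_of_bothLightCells`).
builds on p205010 (kernel theorem, internal audit signed; external expert review pending). [this work] [status: open] -/
@[conjecture] def TreeBuiltAD3 : Prop :=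
  ∀ (x : ℝ) (M : ℕ) (μ : ℕ → ℝ), TreeBuilt x M μ → ∀ q : ℝ, 0 < q → q ≤ 1 →
    AD3Decomp (q * x) q (∑ h ∈ Finset.range (M + 1), (h : ℝ) * μ h) M μ

/-- **CONJECTURE `SDECConvClosedTB`: gate-stable DEC is closed under convolution OF TREE-BUILT LAWS** — census-2 g53's `SDECConvClosed`
with both factors restricted to `TreeBuilt x`.  This is exactly what the structural induction `treeBuilt_sdec` consumes
(`treeBuilt_sdec_TB` below); it is implied by `SDECConvClosed` (`sdecConvClosedTB_of_sdecConvClosed`), hence by `SingleGateConvClosed`,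
and — the point of this file — by CW + the light cells + `TreeBuiltAD3`.
builds on p205010 (kernel theorem, internal audit signed; external expert review pending). [this work] [status: open] -/
@[conjecture] def SDECConvClosedTB : Prop :=
  ∀ (x : ℝ) (M₁ M₂ : ℕ) (μ₁ μ₂ : ℕ → ℝ),
    TreeBuilt x M₁ μ₁ → TreeBuilt x M₂ μ₂ → SDEC x M₁ μ₁ → SDEC x M₂ μ₂ → SDEC x (M₁ + M₂) (lconv M₁ M₂ μ₁ μ₂)

/-- `SDECConvClosed ⟹ SDECConvClosedTB` (drop the tree-built hypotheses; the law facts come from `treeBuilt_lawFacts`). [this work] -/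
theorem sdecConvClosedTB_of_sdecConvClosed (hC : SDECConvClosed) : SDECConvClosedTB := by
  intro x M₁ M₂ μ₁ μ₂ h₁ h₂ s₁ s₂
  obtain ⟨hx0, hx1, n1, z1, m1, t1⟩ := treeBuilt_lawFacts h₁
  obtain ⟨-, -, n2, z2, m2, t2⟩ := treeBuilt_lawFacts h₂
  exact hC x M₁ M₂ μ₁ μ₂ hx0 hx1 n1 z1 m1 t1 n2 z2 m2 t2 s₁ s₂

/-! ### The structural induction from the tree-built closure -/

/-- **THE STRUCTURAL INDUCTION FROM `SDECConvClosedTB`** (census-2 g53's `treeBuilt_sdec`, with the tree-built hypotheses of the factors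
available at the convolution step): every tree-built law is a top-affordable probability law on `{0..M}` at a floor in `(0,1)` and is SDEC
there. [this work] -/
theorem treeBuilt_sdec_TB (hC : SDECConvClosedTB) {x : ℝ} {M : ℕ} {μ : ℕ → ℝ} (h : TreeBuilt x M μ) :
    0 < x ∧ x < 1 ∧ (∀ k, 0 ≤ μ k) ∧ (∀ k, M < k → μ k = 0) ∧ (∑ k ∈ Finset.range (M + 1), μ k = 1) ∧
      x * (M : ℝ) ≤ (∑ k ∈ Finset.range (M + 1), (k : ℝ) * μ k) ∧ SDEC x M μ := by
  induction h with
  | nil x₀ hx0 hx1 =>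
    refine ⟨hx0, hx1, fun k => ?_, fun k hk => if_neg (by omega), by simp, by simp, ?_⟩
    · beta_reduce; split_ifs <;> norm_num
    · intro q _ _ j' hj; omega
  | relay x₀ hx0 hx1 =>
    refine ⟨hx0, hx1, fun k => ?_, fun k hk => if_neg (by omega), by simp, by simp; linarith, sdec_relay x₀ hx0 hx1.le⟩
    beta_reduce; split_ifs <;> norm_num
  | @conv x₀ M₁ M₂ μ₁ μ₂ h₁ h₂ ih₁ ih₂ =>
    obtain ⟨hx0, hx1, n1, z1, s1, t1, d1⟩ := ih₁
    obtain ⟨_, _, n2, z2, s2, t2, d2⟩ := ih₂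
    refine ⟨hx0, hx1, lconv_nonneg _ _ _ _ n1 n2, fun k hk => lconv_eq_zero _ _ _ _ k hk, sum_lconv _ _ _ _ s1 s2, ?_,
      hC x₀ M₁ M₂ μ₁ μ₂ h₁ h₂ d1 d2⟩
    rw [sum_mul_lconv _ _ _ _ s1 s2, Nat.cast_add]
    linarith
  | @gate x₀ M₀ μ₀ q hq0 hq1 h ih =>
    obtain ⟨hx0, hx1, n1, z1, s1, t1, d1⟩ := ih
    refine ⟨mul_pos hq0 hx0, by nlinarith, fun k => ?_, fun k hk => ?_, sum_gate _ q _ s1, ?_, sdec_gate d1 q hq0 hq1⟩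
    · simp only [LawDec.gate]; split_ifs <;> nlinarith [n1 k]
    · simp only [LawDec.gate]; rw [z1 k hk, if_neg (by omega)]; ring
    · rw [sum_mul_gate]; nlinarith
  | @mono x₀ x' M₀ μ₀ h hx'0 hxx ih =>
    obtain ⟨hx0, hx1, n1, z1, s1, t1, d1⟩ := ih
    refine ⟨hx'0, lt_of_le_of_lt hxx hx1, n1, z1, s1, ?_, sdec_mono d1 hxx hx1⟩
    have : x' * (M₀ : ℝ) ≤ x₀ * (M₀ : ℝ) := mul_le_mul_of_nonneg_right hxx (Nat.cast_nonneg _)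
    linarith

/-- **`SDECConvClosedTB ⟹ TreeBuiltDEC`**: every tree-built law is DEC(j′) at every layer (below the top by SDEC at gate `1`, at and above
the top by Theorem A). [this work] -/
theorem treeBuiltDEC_of_sdecConvClosedTB (hC : SDECConvClosedTB) : TreeBuiltDEC := by
  intro x M μ h j'
  obtain ⟨hx0, hx1, n1, z1, s1, t1, d1⟩ := treeBuilt_sdec_TB hC h
  by_cases hj : j' < M
  · have := d1 1 one_pos le_rfl j' hj
    rwa [gate_one, one_mul] at this
  · refine decAt_of_top_le M μ n1 z1 s1 x hx1 (fun k hk => ?_) j' (not_lt.1 hj)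
    have hkM : k ≤ M := by
      by_contra hlt
      exact absurd (z1 k (not_le.1 hlt)) (ne_of_gt hk)
    have : x * (k : ℝ) ≤ x * (M : ℝ) := mul_le_mul_of_nonneg_left (by exact_mod_cast hkM) hx0.le
    linarith

/-- **`SDECConvClosedTB ⟹ TreeBuiltFAR`**. [this work] -/
theorem treeBuiltFAR_of_sdecConvClosedTB (hC : SDECConvClosedTB) : TreeBuiltFAR :=
  treeBuiltFAR_of_treeBuiltDEC (treeBuiltDEC_of_sdecConvClosedTB hC)

/-! ### The tree-built closure from CW + the light cells + `TreeBuiltAD3` -/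

/-- **`WindowMixDEC ∧ SGCLightPair ∧ SGCLightTriple ∧ TreeBuiltAD3 ⟹ SDECConvClosedTB`** (one factor decomposed: typer g30's
`singleGateConvClosed_of_lightCells` at floor `q·x` for every gate `q`, the second factor's AD3⁺ decomposition from `TreeBuiltAD3`, the first
factor's single-gate hypotheses from its SDEC datum and tree-built law facts). [this work] -/
theorem sdecConvClosedTB_of_lightCells (hCW : WindowMixDEC) (hL2 : SGCLightPair) (hL3 : SGCLightTriple) (hAD3 : TreeBuiltAD3) :
    SDECConvClosedTB := by
  intro x M₁ M₂ μ₁ μ₂ h₁ h₂ s₁ _ q hq0 hq1 j' hj'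
  obtain ⟨hx0, hx1, n1, z1, m1, t1⟩ := treeBuilt_lawFacts h₁
  obtain ⟨κ, _, v, ω, hv0, hv1, hμ₂, hcomp⟩ := hAD3 x M₂ μ₂ h₂ q hq0 hq1
  obtain ⟨-, -, -, -, -, t2⟩ := treeBuilt_lawFacts h₂
  have hy0 : 0 < q * x := mul_pos hq0 hx0
  have hy1 : q * x < 1 := by nlinarith
  have hta₁ : q * x * (M₁ : ℝ) ≤ q * ∑ h ∈ Finset.range (M₁ + 1), (h : ℝ) * μ₁ h := by
    rw [mul_assoc]; exact mul_le_mul_of_nonneg_left t1 hq0.le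
  have hta₂ : q * x * (M₂ : ℝ) ≤ q * ∑ h ∈ Finset.range (M₂ + 1), (h : ℝ) * μ₂ h := by
    rw [mul_assoc]; exact mul_le_mul_of_nonneg_left t2 hq0.le
  exact singleGateConvClosed_of_lightCells hCW hL2 hL3 (q * x) q _ M₁ M₂ μ₁ μ₂ v ω hy0 hy1 hq0 hq1 n1 z1 m1 hta₁
    (fun j hj => s₁ q hq0 hq1 j hj) hta₂ hv0 hv1 hμ₂ hcomp j' hj'

/-- **`WindowMixDEC ∧ PP ∧ PT ∧ TT ∧ TreeBuiltAD3 ⟹ SDECConvClosedTB`** (both factors decomposed: typer g31's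
`singleGateConvClosed_of_bothLightCells` — CW for the heavy components, the three EXPLICIT cells for the light ones). [this work] -/
theorem sdecConvClosedTB_of_bothLightCells (hCW : WindowMixDEC) (hPP : SGCLightPairPair) (hPT : SGCLightPairTriple)
    (hTT : SGCLightTripleTriple) (hAD3 : TreeBuiltAD3) : SDECConvClosedTB := by
  intro x M₁ M₂ μ₁ μ₂ h₁ h₂ s₁ _ q hq0 hq1 j' hj'
  obtain ⟨hx0, hx1, n1, z1, -, t1⟩ := treeBuilt_lawFacts h₁
  obtain ⟨-, -, -, -, -, t2⟩ := treeBuilt_lawFacts h₂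
  obtain ⟨κ₁, _, v₁, ω₁, hv₁0, hv₁1, hμ₁, hcomp₁⟩ := hAD3 x M₁ μ₁ h₁ q hq0 hq1
  obtain ⟨κ₂, _, v₂, ω₂, hv₂0, hv₂1, hμ₂, hcomp₂⟩ := hAD3 x M₂ μ₂ h₂ q hq0 hq1
  have hy0 : 0 < q * x := mul_pos hq0 hx0
  have hy1 : q * x < 1 := by nlinarith
  have hta₁ : q * x * (M₁ : ℝ) ≤ q * ∑ h ∈ Finset.range (M₁ + 1), (h : ℝ) * μ₁ h := by
    rw [mul_assoc]; exact mul_le_mul_of_nonneg_left t1 hq0.le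
  have hta₂ : q * x * (M₂ : ℝ) ≤ q * ∑ h ∈ Finset.range (M₂ + 1), (h : ℝ) * μ₂ h := by
    rw [mul_assoc]; exact mul_le_mul_of_nonneg_left t2 hq0.le
  exact singleGateConvClosed_of_bothLightCells hCW hPP hPT hTT (q * x) q _ _ M₁ M₂ μ₁ μ₂ v₁ ω₁ v₂ ω₂ hy0 hy1 hq0 hq1 n1 z1
    (fun j hj => s₁ q hq0 hq1 j hj) hta₁ hta₂ hv₁0 hv₁1 hμ₁ hcomp₁ hv₂0 hv₂1 hμ₂ hcomp₂ j' hj'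

end LawDec

/-! ### Down to the R8 tree row -/

/-- **`SDECConvClosedTB ⟹ Quant.FarTreeRow`** (through `TreeBuiltDEC` and lead g20's bridge). [this work] -/
theorem farTreeRow_of_sdecConvClosedTB (hC : LawDec.SDECConvClosedTB) : FarTreeRow :=
  farTreeRow_of_treeBuiltDEC (LawDec.treeBuiltDEC_of_sdecConvClosedTB hC)

/-- **`WindowMixDEC ∧ SGCLightPair ∧ SGCLightTriple ∧ TreeBuiltAD3 ⟹ Quant.FarTreeRow`.** [this work] -/
theorem farTreeRow_of_lightCells (hCW : LawDec.WindowMixDEC) (hL2 : LawDec.SGCLightPair) (hL3 : LawDec.SGCLightTriple)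
    (hAD3 : LawDec.TreeBuiltAD3) : FarTreeRow :=
  farTreeRow_of_sdecConvClosedTB (LawDec.sdecConvClosedTB_of_lightCells hCW hL2 hL3 hAD3)

/-- **`WindowMixDEC ∧ SGCLightPairPair ∧ SGCLightPairTriple ∧ SGCLightTripleTriple ∧ TreeBuiltAD3 ⟹ Quant.FarTreeRow`** — the R8 tree row
from the blob node CW, three EXPLICIT finite-parameter light cells and one structural conjecture about tree-built laws. [this work] -/
theorem farTreeRow_of_bothLightCells (hCW : LawDec.WindowMixDEC) (hPP : LawDec.SGCLightPairPair) (hPT : LawDec.SGCLightPairTriple)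
    (hTT : LawDec.SGCLightTripleTriple) (hAD3 : LawDec.TreeBuiltAD3) : FarTreeRow :=
  farTreeRow_of_sdecConvClosedTB (LawDec.sdecConvClosedTB_of_bothLightCells hCW hPP hPT hTT hAD3)

end Quant

end Summit.CriticalPhenomena.PercolationContinuityZ3.Theorems
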